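import Summits.QuantumAdvantage.QuantumAdvantage.Theorems.LocusDialAffinePointerB

/-!
# LocusDialAffinePointerC — fibres of an `𝔽₃`-linear hash and `affinePointerLoss3 : AffinePointerLoss3` PROVED (part C of 3)

Cell decomp-qadv, seat lens-2, generation 17 — tree part «AffinePointer» of the node «LocusDial»/«StabilizerDial»
(supports item stmt-QuantumAdvantage-27137 `Theses.StabilizerDial.FewLocusLoss3` ≡ `Theorems.LocusDial.FewLocusLoss3`, whose
first necessary leaf is `AffinePointerLoss3`: tree chain `freePointerLoss3_of_fewLocusLoss3`, `affinePointerLoss3_of_freePointerLoss3`).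

THE THEOREM (part C, `affinePointerLoss3 : AffinePointerLoss3`, constant `C = 1`): in the mod-3 ring game on the odd class, a
strategy whose answer pointer is ANY lookup `π` of ANY `t ≤ (log₂ n)^c` `𝔽₃`-LINEAR FORMS of the input bits (`linHash`) hits a
kernel position (`gCond`) on at most `(1 - 1/n)·2^{n-1}` inputs — in fact on at most `3/4` of the odd class.

THE METHOD (new in the tree: a TRANSFER OPERATOR for the zero-parity walk).  The kernel condition at position `k` reads
`φ_k(x) = k + n + W_k(x) + W(x) ≢ 2 (mod 3)` with `W_k` the occupation count of the prefix zero-parity walk `u_i(x)`.  On a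
fibre `{linHash M x = v}` the pointer is constant (`= π v`); the fibre indicator expands by `𝔽₃`-character orthogonality
(`sum_χ_lin`) into `3^{-t} Σ_λ χ(⟨λ, linHash x - v⟩)`, and each resulting sum `Σ_{x odd} χ(Σ_i μ_i[x_i] + a(W_k + W))` is computed
EXACTLY by a two-state recursion over the walk (`trR`, states = current parity; `trS_eq : S_k = 2^{n-k}·R_k`) whose `ℓ²`-mass
`trQ` contracts by `12/16` every two steps as soon as the occupation phase is nonzero (`trQ_two_step`; here `c_i = a(1 + [i<k])
≠ 0` for all `i < n-1`).  Hence every fibre sum is `≤ 2^n/(16·3^t)` once `n ≥ 16t + 42` (`pow_budget`), the losing inputs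
(`φ = 2`) number `≥ (#odd - 2^n/8)/3 ≥ 2^{n-3}` by pointwise orthogonality (`fibre_count`), and the wins are `≤ 2^{n-1} - 2^{n-3}`.
`t ≤ (log₂ n)^c ≤ √n` eventually is the tree's `TubePlanProof.logPow_le_natSqrt`.

WHAT THIS IS NOT: it is not `FreePointerLoss3` (pointer = arbitrary low-degree polynomials) nor `U = FewLocusLoss3`; the
transfer operator handles phases that are LINEAR in the bits plus the two occupation counts — the degree-`(log n)^c` pointer
of `U` is the next rung (g18).  No `sorry`; standard axioms; no instances, no notation.

PART C (this file): §D the kernel phase `kph` (`gCond_iff_kph`), the application phases `μA` / `cA` (`cA_ne_zero`,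
`phaseK_app`, `normSq_appSum_le`, `norm_appSum_le` with the exponent budget `pow_budget` / `pow_budget'`), the fibres `fib`
and fibre sums `fibSum` of the hash (`fibre_indicator`, `fibSum_expand`, `fibSum_bound`, `fibre_count`, `fibre_count_le`),
and the theorem `affinePointerLoss3` (`C = 1`, `n₀ = max n₁(c) 4096`).
-/

set_option linter.dupNamespace false

noncomputable section

open scoped Classical

namespace Summit.QuantumAdvantage.QuantumAdvantage.Theorems.LocusDial

open Finset
open Literature.Computability.QuantumComplexity Literature.Computability.QuantumComplexity.RingHLF
open Summit.QuantumAdvantage.AdviceFreeQNC0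
open Summit.QuantumAdvantage.QuantumAdvantage.Theorems.HolonomyDial (gCond)

/-! ## §D  Application: kernel phases, fibres of an `𝔽₃`-linear hash, and `AffinePointerLoss3` -/

section Application

variable {N : ℕ}

/-- the kernel phase at position `k`: `φ_k(x) = k + N + W_k(x) + W(x) (mod 3)`; `gCond x k ↔ φ_k(x) ≠ 2`. -/
def kph (x : Fin N → Bool) (k : ℕ) : ZMod 3 := ((k + N + Wk x k + Wk x (N - 1) : ℕ) : ZMod 3)

/-- LocusDialAffinePointerC helper `gCond_iff_kph` (decomp-qadv land package; see the module docstring). -/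
theorem gCond_iff_kph (x : Fin N → Bool) (k : ℕ) : gCond x k ↔ kph x k ≠ 2 := by
  have h2 : (2 : ZMod 3) = ((2 : ℕ) : ZMod 3) := by norm_num
  unfold kph gCond
  rw [h2, Ne, Ne, ZMod.natCast_eq_natCast_iff']

/-- bit phases from a coefficient vector. -/
def μA (μ' : Fin N → ZMod 3) : ℕ → ZMod 3 := fun i => if h : i < N then μ' ⟨i, h⟩ else 0

/-- occupation phases of `a·(W_k + W)`: `c_i = a·([i < k] + [i < N-1])`. -/
def cA (N : ℕ) (a : ZMod 3) (k : ℕ) : ℕ → ZMod 3 :=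
  fun i => a * ((if i < k then 1 else 0) + (if i < N - 1 then 1 else 0))

/-- LocusDialAffinePointerC helper `cA_ne_zero` (decomp-qadv land package; see the module docstring). -/
theorem cA_ne_zero {a : ZMod 3} (ha : a ≠ 0) (k i : ℕ) (hi : i + 1 < N) : cA N a k i ≠ 0 := by
  unfold cA
  rw [if_pos (show i < N - 1 by omega)]
  have hmem : a ∈ (univ : Finset (ZMod 3)) := mem_univ a
  rw [univ_zmod3] at hmem
  simp only [mem_insert, mem_singleton] at hmem
  rcases hmem with rfl | rfl | rfl
  · exact absurd rfl ha
  · split_ifs <;> decide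
  · split_ifs <;> decide

/-- LocusDialAffinePointerC helper `Wk_cast` (decomp-qadv land package; see the module docstring). -/
theorem Wk_cast (x : Fin N → Bool) (k : ℕ) :
    ((Wk x k : ℕ) : ZMod 3) = ∑ i : Fin N, if (i.val < k ∧ uCoord x i = true) then (1 : ZMod 3) else 0 := by
  unfold Wk
  rw [card_filter]
  push_cast
  rfl

/-- the full phase of the application: `Φ_N(x) = Σ_i μ'_i·[x_i] + a·(W_k(x) + W(x))`. -/
theorem phaseK_app (μ' : Fin N → ZMod 3) (a : ZMod 3) (k : ℕ) (x : Fin N → Bool) :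
    phaseK (μA μ') (cA N a k) N x =
      (∑ i : Fin N, μ' i * (if x i then 1 else 0)) + a * (((Wk x k : ℕ) : ZMod 3) + ((Wk x (N - 1) : ℕ) : ZMod 3)) := by
  unfold phaseK
  rw [Wk_cast, Wk_cast, ← sum_add_distrib, mul_sum, ← sum_add_distrib]
  apply sum_congr rfl
  intro i _
  rw [if_pos i.isLt]
  have hμ : μA μ' i.val = μ' i := by
    unfold μA; rw [dif_pos i.isLt]
  rw [hμ]
  unfold cA
  by_cases hu : uCoord x i = true
  · simp [hu]
  · simp [hu]

/-- **odd-class character sum bound, application form**: for every coefficient vector `μ'`, every `a ≠ 0` and every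
position `k`, `|Σ_{x odd} χ(Σ_i μ'_i [x_i] + a(W_k(x) + W(x)))|² ≤ 4^{N-2j}·12^j`, `j = ⌊(N-1)/2⌋`. -/
theorem normSq_appSum_le (μ' : Fin N → ZMod 3) {a : ZMod 3} (ha : a ≠ 0) (k : ℕ) :
    Complex.normSq (∑ x ∈ (univ : Finset (Fin N → Bool)).filter (fun x => OddZeros x),
      χ ((∑ i : Fin N, μ' i * (if x i then 1 else 0)) +
        a * (((Wk x k : ℕ) : ZMod 3) + ((Wk x (N - 1) : ℕ) : ZMod 3)))) ≤
      4 ^ (N - 2 * ((N - 1) / 2)) * 12 ^ ((N - 1) / 2) := by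
  have h := normSq_oddSum_le (N := N) (μA μ') (cA N a k) (fun i hi => cA_ne_zero ha k i hi)
  simp_rw [phaseK_app] at h
  exact h

/-! ### arithmetic of the exponent budget -/

/-- LocusDialAffinePointerC helper `pow_budget` (decomp-qadv land package; see the module docstring). -/
theorem pow_budget (t j : ℕ) (h : 8 * t + 20 ≤ j) : 256 * 9 ^ t * 3 ^ j ≤ 4 ^ j := by
  obtain ⟨r, rfl⟩ : ∃ r, j = 8 * t + 20 + r := ⟨j - (8 * t + 20), by omega⟩
  have e3 : 3 ^ (8 * t + 20 + r) = (3 ^ 8) ^ t * 3 ^ 20 * 3 ^ r := by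
    rw [pow_add, pow_add, pow_mul]
  have e4 : 4 ^ (8 * t + 20 + r) = (4 ^ 8) ^ t * 4 ^ 20 * 4 ^ r := by
    rw [pow_add, pow_add, pow_mul]
  rw [e3, e4]
  have h1 : 9 ^ t * (3 ^ 8) ^ t ≤ (4 ^ 8) ^ t := by
    rw [← mul_pow]; exact Nat.pow_le_pow_left (by norm_num) t
  have h2 : 256 * 3 ^ 20 ≤ 4 ^ 20 := by norm_num
  have h3 : 3 ^ r ≤ 4 ^ r := Nat.pow_le_pow_left (by norm_num) r
  calc 256 * 9 ^ t * ((3 ^ 8) ^ t * 3 ^ 20 * 3 ^ r) = (9 ^ t * (3 ^ 8) ^ t) * (256 * 3 ^ 20) * 3 ^ r := by ring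
    _ ≤ (4 ^ 8) ^ t * 4 ^ 20 * 4 ^ r := Nat.mul_le_mul (Nat.mul_le_mul h1 h2) h3
/-- LocusDialAffinePointerC helper `pow_budget'` (decomp-qadv land package; see the module docstring). -/
theorem pow_budget' (t N : ℕ) (hN : 16 * t + 42 ≤ N) :
    (256 : ℝ) * 9 ^ t * (4 ^ (N - 2 * ((N - 1) / 2)) * 12 ^ ((N - 1) / 2)) ≤ 4 ^ N := by
  set j := (N - 1) / 2 with hj
  have h2j : 2 * j ≤ N := by omega
  have hjt : 8 * t + 20 ≤ j := by omega
  have hb := pow_budget t j hjt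
  have e12 : (12 : ℝ) ^ j = 3 ^ j * 4 ^ j := by rw [← mul_pow]; norm_num
  have e4 : (4 : ℝ) ^ N = 4 ^ (N - 2 * j) * 4 ^ j * 4 ^ j := by
    rw [← pow_add, ← pow_add]; congr 1; omega
  rw [e12, e4]
  have hbR : (256 : ℝ) * 9 ^ t * 3 ^ j ≤ 4 ^ j := by exact_mod_cast hb
  have hp : (0 : ℝ) ≤ 4 ^ (N - 2 * j) * 4 ^ j := by positivity
  calc (256 : ℝ) * 9 ^ t * (4 ^ (N - 2 * j) * (3 ^ j * 4 ^ j))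
      = (4 ^ (N - 2 * j) * 4 ^ j) * (256 * 9 ^ t * 3 ^ j) := by ring
    _ ≤ (4 ^ (N - 2 * j) * 4 ^ j) * 4 ^ j := mul_le_mul_of_nonneg_left hbR hp
    _ = 4 ^ (N - 2 * j) * 4 ^ j * 4 ^ j := by ring
/-- the application bound in the usable form `16·3^t·‖Σ‖ ≤ 2^N`. -/
theorem norm_appSum_le (μ' : Fin N → ZMod 3) {a : ZMod 3} (ha : a ≠ 0) (k t : ℕ) (hN : 16 * t + 42 ≤ N) :
    (16 : ℝ) * 3 ^ t * ‖∑ x ∈ (univ : Finset (Fin N → Bool)).filter (fun x => OddZeros x),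
      χ ((∑ i : Fin N, μ' i * (if x i then 1 else 0)) +
        a * (((Wk x k : ℕ) : ZMod 3) + ((Wk x (N - 1) : ℕ) : ZMod 3)))‖ ≤ 2 ^ N := by
  set Z := ∑ x ∈ (univ : Finset (Fin N → Bool)).filter (fun x => OddZeros x),
      χ ((∑ i : Fin N, μ' i * (if x i then 1 else 0)) +
        a * (((Wk x k : ℕ) : ZMod 3) + ((Wk x (N - 1) : ℕ) : ZMod 3))) with hZ
  have h1 : Complex.normSq Z ≤ 4 ^ (N - 2 * ((N - 1) / 2)) * 12 ^ ((N - 1) / 2) := normSq_appSum_le μ' ha k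
  have h2 := pow_budget' t N hN
  rw [Complex.normSq_eq_norm_sq] at h1
  have hsq : ((16 : ℝ) * 3 ^ t * ‖Z‖) ^ 2 ≤ ((2 : ℝ) ^ N) ^ 2 := by
    have e : ((2 : ℝ) ^ N) ^ 2 = 4 ^ N := by rw [← pow_mul, mul_comm, pow_mul]; norm_num
    rw [e]
    have : (0 : ℝ) ≤ 256 * 9 ^ t := by positivity
    calc ((16 : ℝ) * 3 ^ t * ‖Z‖) ^ 2 = 256 * 9 ^ t * ‖Z‖ ^ 2 := by
          rw [mul_pow, mul_pow, ← pow_mul, show (16 : ℝ) ^ 2 = 256 by norm_num]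
          congr 2
          rw [mul_comm, pow_mul]; norm_num
      _ ≤ 256 * 9 ^ t * (4 ^ (N - 2 * ((N - 1) / 2)) * 12 ^ ((N - 1) / 2)) :=
          mul_le_mul_of_nonneg_left h1 this
      _ ≤ 4 ^ N := h2
  have ha0 : (0 : ℝ) ≤ 16 * 3 ^ t * ‖Z‖ := by positivity
  have hb0 : (0 : ℝ) ≤ 2 ^ N := by positivity
  calc (16 : ℝ) * 3 ^ t * ‖Z‖ = Real.sqrt (((16 : ℝ) * 3 ^ t * ‖Z‖) ^ 2) := (Real.sqrt_sq ha0).symm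
    _ ≤ Real.sqrt (((2 : ℝ) ^ N) ^ 2) := Real.sqrt_le_sqrt hsq
    _ = 2 ^ N := Real.sqrt_sq hb0

/-! ### fibres of the hash -/

variable {t : ℕ}
/-- the odd-class fibre of the hash over `v`. -/
def fib (M : Fin t → Fin N → ZMod 3) (v : Fin t → ZMod 3) : Finset (Fin N → Bool) :=
  ((univ : Finset (Fin N → Bool)).filter (fun x => OddZeros x)).filter (fun x => linHash M x = v)
/-- the character sum of the kernel phase over a fibre. -/
def fibSum (M : Fin t → Fin N → ZMod 3) (v : Fin t → ZMod 3) (a : ZMod 3) (k : ℕ) : ℂ :=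
  ∑ x ∈ fib M v, χ (a * (kph x k - 2))
/-- LocusDialAffinePointerC helper `fibre_indicator` (decomp-qadv land package; see the module docstring). -/
theorem fibre_indicator (M : Fin t → Fin N → ZMod 3) (x : Fin N → Bool) (v : Fin t → ZMod 3) :
    (3 : ℂ) ^ t * (if linHash M x = v then 1 else 0) =
      ∑ lam : Fin t → ZMod 3, χ (∑ s : Fin t, lam s * (linHash M x s - v s)) := by
  rw [sum_χ_lin t (fun s => linHash M x s - v s)]
  by_cases h : linHash M x = v
  · rw [if_pos h, if_pos (funext fun s => by simp [h]), mul_one]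
  · rw [if_neg h, mul_zero, if_neg]
    intro h0
    apply h
    funext s
    have := congr_fun h0 s
    simpa [sub_eq_zero] using this
/-- LocusDialAffinePointerC helper `lam_hash` (decomp-qadv land package; see the module docstring). -/
theorem lam_hash (lam : Fin t → ZMod 3) (M : Fin t → Fin N → ZMod 3) (x : Fin N → Bool) (v : Fin t → ZMod 3) :
    ∑ s : Fin t, lam s * (linHash M x s - v s) =
      (∑ i : Fin N, (∑ s : Fin t, lam s * M s i) * (if x i then 1 else 0)) - ∑ s : Fin t, lam s * v s := by
  simp only [linHash, mul_sub, sum_sub_distrib, mul_sum, sum_mul]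
  congr 1
  rw [sum_comm]
  apply sum_congr rfl; intro i _
  apply sum_congr rfl; intro s _
  ring
/-- LocusDialAffinePointerC helper `kph_expand` (decomp-qadv land package; see the module docstring). -/
theorem kph_expand (x : Fin N → Bool) (k : ℕ) (a : ZMod 3) :
    a * (kph x k - 2) = a * (((Wk x k : ℕ) : ZMod 3) + ((Wk x (N - 1) : ℕ) : ZMod 3)) +
      (a * ((k + N : ℕ) : ZMod 3) - 2 * a) := by
  unfold kph
  push_cast
  ring
/-- the fibre sum, Fourier-expanded over the hash. -/
theorem fibSum_expand (M : Fin t → Fin N → ZMod 3) (v : Fin t → ZMod 3) (a : ZMod 3) (k : ℕ) :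
    (3 : ℂ) ^ t * fibSum M v a k = ∑ lam : Fin t → ZMod 3,
      (∑ x ∈ (univ : Finset (Fin N → Bool)).filter (fun x => OddZeros x),
        χ ((∑ i : Fin N, (∑ s : Fin t, lam s * M s i) * (if x i then 1 else 0)) +
          a * (((Wk x k : ℕ) : ZMod 3) + ((Wk x (N - 1) : ℕ) : ZMod 3)))) *
      χ (a * ((k + N : ℕ) : ZMod 3) - 2 * a - ∑ s : Fin t, lam s * v s) := by
  unfold fibSum fib
  rw [sum_filter, mul_sum]
  have hpt : ∀ x : Fin N → Bool, (3 : ℂ) ^ t * (if linHash M x = v then χ (a * (kph x k - 2)) else 0) =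
      ∑ lam : Fin t → ZMod 3, χ ((∑ i : Fin N, (∑ s : Fin t, lam s * M s i) * (if x i then 1 else 0)) +
          a * (((Wk x k : ℕ) : ZMod 3) + ((Wk x (N - 1) : ℕ) : ZMod 3))) *
        χ (a * ((k + N : ℕ) : ZMod 3) - 2 * a - ∑ s : Fin t, lam s * v s) := by
    intro x
    have e : (if linHash M x = v then χ (a * (kph x k - 2)) else 0) =
        (if linHash M x = v then (1 : ℂ) else 0) * χ (a * (kph x k - 2)) := by
      split_ifs <;> simp
    rw [e, ← mul_assoc, fibre_indicator, sum_mul]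
    apply sum_congr rfl
    intro lam _
    rw [← χ_add, ← χ_add, lam_hash, kph_expand]
    ring_nf
  simp_rw [hpt]
  rw [sum_comm]
  apply sum_congr rfl
  intro lam _
  rw [sum_mul]
/-- **fibre bound**: `16·3^t·|fibSum| ≤ 2^N` (`a ≠ 0`, `16t + 42 ≤ N`). -/
theorem fibSum_bound (M : Fin t → Fin N → ZMod 3) (v : Fin t → ZMod 3) {a : ZMod 3} (ha : a ≠ 0) (k : ℕ)
    (hN : 16 * t + 42 ≤ N) : (16 : ℝ) * 3 ^ t * ‖fibSum M v a k‖ ≤ 2 ^ N := by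
  have hexp := fibSum_expand M v a k
  have hnorm : (3 : ℝ) ^ t * ‖fibSum M v a k‖ ≤ ∑ lam : Fin t → ZMod 3,
      ‖∑ x ∈ (univ : Finset (Fin N → Bool)).filter (fun x => OddZeros x),
        χ ((∑ i : Fin N, (∑ s : Fin t, lam s * M s i) * (if x i then 1 else 0)) +
          a * (((Wk x k : ℕ) : ZMod 3) + ((Wk x (N - 1) : ℕ) : ZMod 3)))‖ := by
    have h3 : ‖(3 : ℂ) ^ t * fibSum M v a k‖ = (3 : ℝ) ^ t * ‖fibSum M v a k‖ := by
      rw [norm_mul, norm_pow]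
      simp
    rw [← h3, hexp]
    refine (norm_sum_le _ _).trans ?_
    apply sum_le_sum
    intro lam _
    rw [norm_mul, norm_χ, mul_one]
  have hper : ∀ lam : Fin t → ZMod 3, (16 : ℝ) * 3 ^ t *
      ‖∑ x ∈ (univ : Finset (Fin N → Bool)).filter (fun x => OddZeros x),
        χ ((∑ i : Fin N, (∑ s : Fin t, lam s * M s i) * (if x i then 1 else 0)) +
          a * (((Wk x k : ℕ) : ZMod 3) + ((Wk x (N - 1) : ℕ) : ZMod 3)))‖ ≤ 2 ^ N :=
    fun lam => norm_appSum_le (fun i => ∑ s : Fin t, lam s * M s i) ha k t hN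
  have hsum := sum_le_sum (fun lam (_ : lam ∈ (univ : Finset (Fin t → ZMod 3))) => hper lam)
  rw [← mul_sum, sum_const, card_univ, Fintype.card_fun, ZMod.card, Fintype.card_fin, nsmul_eq_mul] at hsum
  push_cast at hsum
  have h3pos : (0 : ℝ) < 3 ^ t := by positivity
  nlinarith [hnorm, hsum, norm_nonneg (fibSum M v a k)]
/-- **per-fibre count**: `3·#{x ∈ fib : φ_k(x) = 2} = #fib + fibSum₁ + fibSum₂` (pointwise orthogonality). -/
theorem fibre_count (M : Fin t → Fin N → ZMod 3) (v : Fin t → ZMod 3) (k : ℕ) :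
    (((3 * ((fib M v).filter (fun x => kph x k = 2)).card : ℕ)) : ℂ) =
      ((fib M v).card : ℂ) + fibSum M v 1 k + fibSum M v 2 k := by
  unfold fibSum
  rw [card_eq_sum_ones (fib M v)]
  push_cast
  rw [← sum_add_distrib, ← sum_add_distrib]
  have hpt : ∀ x : Fin N → Bool, (1 : ℂ) + χ (1 * (kph x k - 2)) + χ (2 * (kph x k - 2)) =
      if kph x k = 2 then 3 else 0 := by
    intro x
    rw [one_mul, one_add_χ_add_χ (kph x k - 2)]
    simp only [sub_eq_zero]
  simp_rw [hpt]
  rw [sum_ite, sum_const_zero, add_zero, sum_const, nsmul_eq_mul, mul_comm]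
/-- LocusDialAffinePointerC helper `fibre_count_le` (decomp-qadv land package; see the module docstring). -/
theorem fibre_count_le (M : Fin t → Fin N → ZMod 3) (v : Fin t → ZMod 3) (k : ℕ) :
    ((fib M v).card : ℝ) ≤ 3 * ((fib M v).filter (fun x => kph x k = 2)).card +
      ‖fibSum M v 1 k‖ + ‖fibSum M v 2 k‖ := by
  have h := fibre_count M v k
  have e : ((fib M v).card : ℂ) = (((3 * ((fib M v).filter (fun x => kph x k = 2)).card : ℕ)) : ℂ) -
      fibSum M v 1 k - fibSum M v 2 k := by rw [h]; ring
  have hn : ‖((fib M v).card : ℂ)‖ ≤ ‖(((3 * ((fib M v).filter (fun x => kph x k = 2)).card : ℕ)) : ℂ)‖ +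
      ‖fibSum M v 1 k‖ + ‖fibSum M v 2 k‖ := by
    rw [e]
    refine (norm_sub_le _ _).trans ?_
    have := norm_sub_le ((((3 * ((fib M v).filter (fun x => kph x k = 2)).card : ℕ)) : ℂ)) (fibSum M v 1 k)
    linarith
  rw [Complex.norm_natCast, Complex.norm_natCast] at hn
  push_cast at hn
  exact hn

/-! ### the theorem -/
/-- **`AffinePointerLoss3` PROVED** (with `C = 1`): a pointer that is ANY function of ANY number `t ≤ (log₂ n)^c` of
`𝔽₃`-linear forms of the input bits hits the kernel on at most a `1 - 1/n` fraction (indeed `≤ 3/4`) of the odd class. -/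
theorem affinePointerLoss3 : AffinePointerLoss3 := by
  refine ⟨1, fun c => ?_⟩
  obtain ⟨n₁, hn₁⟩ := TubePlanProof.logPow_le_natSqrt c
  refine ⟨max n₁ 4096, fun n hn t ht M π => ?_⟩
  have hn1 : n₁ ≤ n := le_trans (le_max_left _ _) hn
  have h4096 : 4096 ≤ n := le_trans (le_max_right _ _) hn
  have hsq : (Nat.log 2 n) ^ c ≤ Nat.sqrt n := hn₁ n hn1
  have hs64 : 64 ≤ Nat.sqrt n := Nat.le_sqrt.2 (by omega)
  have hss : Nat.sqrt n * Nat.sqrt n ≤ n := Nat.sqrt_le n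
  have htN : 16 * t + 42 ≤ n := by nlinarith [ht, hsq, hs64, hss]
  -- the sets
  set Odd := (univ : Finset (Fin n → Bool)).filter (fun x => OddZeros x) with hOdd
  set G : (Fin n → Bool) → Prop := fun x => gCond x (π (linHash M x)).val with hG
  set L := Odd.filter (fun x => kph x (π (linHash M x)).val = 2) with hL
  have hW : (univ.filter fun x : Fin n → Bool => OddZeros x ∧ gCond x (π (linHash M x)).val) = Odd.filter G := by
    rw [hOdd, filter_filter]
  have hLG : L = Odd.filter (fun x => ¬ G x) := by
    rw [hL]
    apply filter_congr
    intro x _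
    rw [hG]
    simp only [gCond_iff_kph, not_not]
  have hWL : (Odd.filter G).card + L.card = Odd.card := by
    rw [hLG]
    exact card_filter_add_card_filter_not _
  have hOdd_le : Odd.card ≤ 2 ^ (n - 1) := HolonomyDial.card_odd_le (by omega)
  have hOdd_ge : 2 ^ (n - 1) ≤ Odd.card := AnchorDial.card_odd_ge (by omega)
  -- fibres
  have hOdd_fib : Odd.card = ∑ v : Fin t → ZMod 3, (fib M v).card := by
    rw [card_eq_sum_card_fiberwise (f := fun x => linHash M x) (t := (univ : Finset (Fin t → ZMod 3)))
      (fun x _ => mem_univ _)]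
    rfl
  have hL_fib : L.card = ∑ v : Fin t → ZMod 3, ((fib M v).filter (fun x => kph x (π v).val = 2)).card := by
    rw [card_eq_sum_card_fiberwise (f := fun x => linHash M x) (t := (univ : Finset (Fin t → ZMod 3)))
      (fun x _ => mem_univ _)]
    apply sum_congr rfl
    intro v _
    congr 1
    rw [hL]
    unfold fib
    ext x
    simp only [hOdd, mem_filter, mem_univ, true_and]
    constructor
    · rintro ⟨⟨hx, hk⟩, hv⟩
      exact ⟨⟨hx, hv⟩, by rw [← hv]; exact hk⟩
    · rintro ⟨⟨hx, hv⟩, hk⟩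
      exact ⟨⟨hx, by rw [hv]; exact hk⟩, hv⟩
  have hfib : ∀ v : Fin t → ZMod 3, ((fib M v).card : ℝ) ≤
      3 * ((fib M v).filter (fun x => kph x (π v).val = 2)).card + 2 ^ n / (8 * 3 ^ t) := by
    intro v
    have h0 := fibre_count_le M v (π v).val
    have h1 := fibSum_bound M v (show (1 : ZMod 3) ≠ 0 by decide) (π v).val htN
    have h2 := fibSum_bound M v (show (2 : ZMod 3) ≠ 0 by decide) (π v).val htN
    have h3pos : (0 : ℝ) < 8 * 3 ^ t := by positivity
    have hb1 : ‖fibSum M v 1 (π v).val‖ ≤ 2 ^ n / (16 * 3 ^ t) := by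
      rw [le_div_iff₀ (by positivity)]; linarith
    have hb2 : ‖fibSum M v 2 (π v).val‖ ≤ 2 ^ n / (16 * 3 ^ t) := by
      rw [le_div_iff₀ (by positivity)]; linarith
    have e : (2 : ℝ) ^ n / (16 * 3 ^ t) + 2 ^ n / (16 * 3 ^ t) = 2 ^ n / (8 * 3 ^ t) := by
      field_simp; ring
    linarith
  have hmain : (Odd.card : ℝ) ≤ 3 * L.card + 2 ^ n / 8 := by
    rw [hOdd_fib, hL_fib]
    push_cast
    have hs := sum_le_sum (fun v (_ : v ∈ (univ : Finset (Fin t → ZMod 3))) => hfib v)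
    rw [sum_add_distrib, sum_const, card_univ, Fintype.card_fun, ZMod.card, Fintype.card_fin, nsmul_eq_mul,
      ← mul_sum] at hs
    push_cast at hs
    have e : (3 : ℝ) ^ t * (2 ^ n / (8 * 3 ^ t)) = 2 ^ n / 8 := by
      field_simp
    linarith
  -- the count
  rw [hW]
  have hWr : ((Odd.filter G).card : ℝ) = Odd.card - L.card := by
    have := congrArg (fun m : ℕ => (m : ℝ)) hWL
    push_cast at this
    linarith
  have hOl : (Odd.card : ℝ) ≤ 2 ^ (n - 1) := by exact_mod_cast hOdd_le
  have hOg : (2 : ℝ) ^ (n - 1) ≤ Odd.card := by exact_mod_cast hOdd_ge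
  have hpow : (2 : ℝ) ^ n = 2 * 2 ^ (n - 1) := by
    rw [← pow_succ']; congr 1; omega
  have hn4 : (4 : ℝ) ≤ n := by exact_mod_cast h4096.trans' (by norm_num)
  have h1n : 1 / (n : ℝ) ^ 1 ≤ 1 / 4 := by
    rw [pow_one]; exact one_div_le_one_div_of_le (by norm_num) hn4
  have hpos : (0 : ℝ) ≤ 2 ^ (n - 1) := by positivity
  have hrhs : (3 / 4 : ℝ) * 2 ^ (n - 1) ≤ (1 - 1 / (n : ℝ) ^ 1) * 2 ^ (n - 1) :=
    mul_le_mul_of_nonneg_right (by linarith) hpos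
  rw [hWr]
  linarith

end Application


end Summit.QuantumAdvantage.QuantumAdvantage.Theorems.LocusDial
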